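import Literature.AnabelianGeometry.SemiGraphs.CompactInVerticialAtCoveringGraph
import Literature.AnabelianGeometry.SemiGraphs.TemperedThm37OfCompactInVerticialAt
import Literature.AnabelianGeometry.SemiGraphs.TemperedCompactInVerticialFinite
import HarnessLib

/-!
# [SemiAnbd] Thm 3.7 (iv) AT a covering semi-graph of anabelioids, and (iii)/(iv) AT every tempered
covering graph of a FINITE graph of anabelioids

Mochizuki, *Semi-graphs of anabelioids*, Publ. RIMS **42** (2006), §3, Theorem 3.7 (iii)/(iv) pp. 40–41
("Every compact subgroup of `π₁^temp(G)` is contained in at least one verticial subgroup …"; "The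
maximal compact subgroups of `π₁^temp(G)` are precisely the verticial subgroups. The nontrivial
intersections of two distinct maximal compact subgroups … are precisely the edge-like subgroups")
[cite: MochizukiSemiAnbd2006, Thm 3.7(iii)(iv) pp.40-41].  Corollaries of the transfer along tempered
coverings `CovObj.compactInVerticialAt_coveringGraph` (route-T brick T3):

* (T4a) the per-graph forms `MaximalCompactIffVerticialAt`, `EdgeLikeIsInfVerticialAt`,
  `EdgeLikeDistinctAt` hold at the covering semi-graph of anabelioids `G_S` of every connected tempered
  covering `S` of a coherent `G` as in Theorem 3.7 with `CompactInVerticialAt G` — by abc-iut-w4-d075's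
  "(iv) from (iii) alone" (`TemperedThm37OfCompactInVerticialAt`);
* (T4b) print's proof of (iii) assumes `G` FINITE (p. 41 "Since the semi-graphs `𝔾_j` are all
  finite"); the cell proves the per-graph statement at every finite `G`
  (`compactInVerticialAt_of_finiteGraph`, TemperedCompactInVerticialFinite.lean); composing gives Thm. 3.7
  (iii)/(iv) AT the — in general INFINITE — covering semi-graph `G_S` of every connected tempered covering
  `S` of a finite coherent Thm-3.7 graph: the universal graph-coverings `G_{∞,j}` and the infinite cyclic
  coverings of [EtTh] §1 are of this form.  No hypothesis on compact subgroups of `π₁^temp` of an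
  infinite graph is used.

Proof-only (abc-iut cell, L3 route T, brick T4; L3-lead ruling α42 (3)); nothing here asserts Thm 3.7
(iii) for an arbitrary infinite `G`, and nothing bears on [IUTchIII] Cor. 3.12.
-/

namespace Literature.AnabelianGeometry.SemiGraphs

namespace ProfiniteSemiGraph

namespace CovObj

open Literature.AlgebraicGeometry.Frobenioids (IsConnectedObj)

universe u

variable {𝒢 : ProfiniteSemiGraph.{u}} (S : CovObj 𝒢)

/-! ### (iv) and the edge-like corollaries at a covering graph -/

/-- **[SemiAnbd] Theorem 3.7 (iv) transfers along tempered coverings**: maximal compact subgroups of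
`π₁^temp(G_S)` are exactly its verticial subgroups, and the nontrivial intersections of two distinct ones
are exactly the edge-like subgroups of closed edges — for `S` a connected tempered covering of a coherent
`G` as in Thm. 3.7 with `CompactInVerticialAt G`. [cite: MochizukiSemiAnbd2006, Thm 3.7(iv) p.41] -/
theorem maximalCompactIffVerticialAt_coveringGraph (h𝒢 : 𝒢.Thm37Hypotheses) (hcoh : 𝒢.IsCoherent)
    (hiii : CompactInVerticialAt 𝒢) (hS : S.IsTempered) (hSc : IsConnectedObj (⟨S, hS⟩ : BTempCat 𝒢)) :
    MaximalCompactIffVerticialAt S.coveringGraph :=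
  maximalCompactIffVerticialAt_of_compactInVerticialAt (S.compactInVerticialAt_coveringGraph h𝒢 hcoh hiii hS hSc)

/-- **The rung-4 residual `EdgeLikeIsInfVerticialAt` transfers along tempered coverings**: every
nontrivial edge-like subgroup of a closed edge of `G_S` is the intersection of two distinct verticial
subgroups. [cite: MochizukiSemiAnbd2006, Thm 3.7(iv) p.41] -/
theorem edgeLikeIsInfVerticialAt_coveringGraph (h𝒢 : 𝒢.Thm37Hypotheses) (hcoh : 𝒢.IsCoherent)
    (hiii : CompactInVerticialAt 𝒢) (hS : S.IsTempered) (hSc : IsConnectedObj (⟨S, hS⟩ : BTempCat 𝒢)) :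
    EdgeLikeIsInfVerticialAt S.coveringGraph :=
  edgeLikeIsInfVerticialAt_of_compactInVerticialAt (S.compactInVerticialAt_coveringGraph h𝒢 hcoh hiii hS hSc)

/-- **Thm 3.7 (ii), edge form, transfers along tempered coverings**: edge-like subgroups of distinct edges
of `G_S` have infinite mutual index. [cite: MochizukiSemiAnbd2006, Thm 3.7(ii)(iv) pp.40-41] -/
theorem edgeLikeDistinctAt_coveringGraph (h𝒢 : 𝒢.Thm37Hypotheses) (hcoh : 𝒢.IsCoherent)
    (hiii : CompactInVerticialAt 𝒢) (hS : S.IsTempered) (hSc : IsConnectedObj (⟨S, hS⟩ : BTempCat 𝒢)) :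
    EdgeLikeDistinctAt S.coveringGraph :=
  edgeLikeDistinctAt_of_compactInVerticialAt (S.compactInVerticialAt_coveringGraph h𝒢 hcoh hiii hS hSc)

/-! ### At every tempered covering graph of a FINITE graph of anabelioids -/

/-- **Thm 3.7 (iii) AT the covering graph of a connected tempered covering of a FINITE coherent
Thm-3.7 graph of anabelioids.** [cite: MochizukiSemiAnbd2006, Thm 3.7(iii) pp.40-41] -/
theorem compactInVerticialAt_coveringGraph_of_finite [Finite 𝒢.graph.Vertex] [Finite 𝒢.graph.Edge]
    (h𝒢 : 𝒢.Thm37Hypotheses) (hcoh : 𝒢.IsCoherent) (hS : S.IsTempered)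
    (hSc : IsConnectedObj (⟨S, hS⟩ : BTempCat 𝒢)) : CompactInVerticialAt S.coveringGraph :=
  S.compactInVerticialAt_coveringGraph h𝒢 hcoh compactInVerticialAt_of_finiteGraph hS hSc

/-- **Thm 3.7 (iv) AT the covering graph of a connected tempered covering of a FINITE coherent
Thm-3.7 graph of anabelioids.** [cite: MochizukiSemiAnbd2006, Thm 3.7(iv) p.41] -/
theorem maximalCompactIffVerticialAt_coveringGraph_of_finite [Finite 𝒢.graph.Vertex]
    [Finite 𝒢.graph.Edge] (h𝒢 : 𝒢.Thm37Hypotheses) (hcoh : 𝒢.IsCoherent) (hS : S.IsTempered)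
    (hSc : IsConnectedObj (⟨S, hS⟩ : BTempCat 𝒢)) : MaximalCompactIffVerticialAt S.coveringGraph :=
  S.maximalCompactIffVerticialAt_coveringGraph h𝒢 hcoh compactInVerticialAt_of_finiteGraph hS hSc

/-- The edge-like corollaries at such covering graphs. [cite: MochizukiSemiAnbd2006, Thm 3.7(iv) p.41] -/
theorem edgeLikeAt_coveringGraph_of_finite [Finite 𝒢.graph.Vertex] [Finite 𝒢.graph.Edge]
    (h𝒢 : 𝒢.Thm37Hypotheses) (hcoh : 𝒢.IsCoherent) (hS : S.IsTempered)
    (hSc : IsConnectedObj (⟨S, hS⟩ : BTempCat 𝒢)) :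
    EdgeLikeIsInfVerticialAt S.coveringGraph ∧ EdgeLikeDistinctAt S.coveringGraph :=
  ⟨S.edgeLikeIsInfVerticialAt_coveringGraph h𝒢 hcoh compactInVerticialAt_of_finiteGraph hS hSc,
    S.edgeLikeDistinctAt_coveringGraph h𝒢 hcoh compactInVerticialAt_of_finiteGraph hS hSc⟩

end CovObj

end ProfiniteSemiGraph

end Literature.AnabelianGeometry.SemiGraphs
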